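import Summits.ValiantsHypothesis.ValiantsHypothesis.Theorems.DepthWindowSumProdLayer
import HarnessLib

/-!
# Route `DepthWindow`, g8 — iterating the `Σ Π` layer builder

Sequel of `Theorems/DepthWindowSumProdLayer.lean` (gate-level piece (iii) of the `(2,3)` sliver
lemma, lens-4 NODE-v8 §10).  `sumProdDelta c ops L₀ m` appends, for `i = 0, …, m-1` in turn, the
product layer `prodLayer (ops i)` (fan-in `f`, `nJ` gates) and its collecting sum gate
`sumGate (c i) (L₀ + i·(nJ+1))`; the `i`-th sum gate sits at position
`sumProdPos L₀ nJ i = L₀ + i·(nJ+1) + nJ`.  `sumProdDelta_spec` is the invariant after `m` blocks,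
for a prefix `Ψ₀` of length `L₀` that all operands reference: total length, fan-ins, weighted
homogeneity of every value, the `prodWeight`-depth window (old entries, or `≤ D₀ + 1`), and for
every `i < m` the position, the VALUE `Σ_j C (c i j) · ∏_u (ops i j u).eval (gateValues Ψ₀)`, its
homogeneity (weight `W i`) and its depth entry `≤ D₀ + 1`.

With `m = |A|·a` inner blocks followed by ONE more application of the step (outer products of
fan-in `a` over the inner sum gates, outer sum) this realises any
`Σ_α cA α · ∏_{q<a} Σ_β cB α q β · ∏_{u<b} leaf α q β u` expression two product levels above its
leaves — in particular the fixed-endpoint two-level jump formula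
(`weightedHomogeneousComponent_prod_eq_twoLevel_fix`).  Generic bookkeeping over a commutative
semiring; nothing here bears on `VP ≠ VNP`.

[cite: Burgisser2000, Def. 2.1] [cite: LimayeSrinivasanTavenas2025, Lemma 11]
-/

set_option linter.dupNamespace false

namespace Summit.ValiantsHypothesis.ValiantsHypothesis.Theorems.DepthWindow

open MvPolynomial Literature.Computability.AlgebraicComplexity ArithCircuit Finset
open Literature.Computability.AlgebraicComplexity.DepthReduction

variable {k : Type*} [CommSemiring k] {τ : Type*}

/-- The gates appended by `m` successive `Σ Π` steps after a prefix of length `L₀`. -/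
def sumProdDelta {nJ f : ℕ} (c : ℕ → Fin nJ → k) (ops : ℕ → Fin nJ → Fin f → Operand k τ)
    (L₀ : ℕ) : ℕ → List (Gate k τ)
  | 0 => []
  | m + 1 => sumProdDelta c ops L₀ m ++ (prodLayer (ops m) ++ [sumGate (c m) (L₀ + m * (nJ + 1))])

/-- Position of the `i`-th collecting sum gate. -/
def sumProdPos (L₀ nJ i : ℕ) : ℕ := L₀ + i * (nJ + 1) + nJ

section Spec

variable (w : τ → ℕ) {nJ f : ℕ} (c : ℕ → Fin nJ → k) (ops : ℕ → Fin nJ → Fin f → Operand k τ)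

omit [CommSemiring k] in
/-- Length after `m` steps. -/
theorem length_sumProdDelta (L₀ : ℕ) : ∀ m : ℕ, (sumProdDelta c ops L₀ m).length = m * (nJ + 1)
  | 0 => by simp [sumProdDelta]
  | m + 1 => by
      rw [sumProdDelta, List.length_append, length_sumProdDelta L₀ m, List.length_append,
        length_prodLayer, List.length_singleton]
      ring

omit [CommSemiring k] in
/-- Fan-ins: every product gate appended has fan-in exactly `f`. -/
theorem fanIn_sumProdDelta (L₀ : ℕ) :
    ∀ (m : ℕ) (vs : List (Operand k τ)), Gate.prod vs ∈ sumProdDelta c ops L₀ m → vs.length = f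
  | 0, vs, h => by simp [sumProdDelta] at h
  | m + 1, vs, h => by
      rw [sumProdDelta, List.mem_append, List.mem_append, List.mem_singleton] at h
      rcases h with h | h | h
      · exact fanIn_sumProdDelta L₀ m vs h
      · exact fanIn_prodLayer (ops m) vs h
      · cases h

/-- **Invariant of the iterated `Σ Π` construction** after `m ≤ n` steps.
[cite: Burgisser2000, Def. 2.1] -/
theorem sumProdDelta_spec (Ψ₀ : List (Gate k τ)) (n D₀ : ℕ) (W : ℕ → ℕ)
    (hrefs : ∀ i < n, ∀ j u, (ops i j u).RefsBelow Ψ₀.length)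
    (hdp : ∀ i < n, ∀ j u, (ops i j u).depthIn (gateWDepths prodWeight Ψ₀) ≤ D₀)
    (hhom₀ : ∀ g ∈ gateValues Ψ₀, ∃ e : ℕ, IsWeightedHomogeneous w g e)
    (hW : ∀ i < n, ∀ j, IsWeightedHomogeneous w (∏ u : Fin f, (ops i j u).eval (gateValues Ψ₀)) (W i)) :
    ∀ m : ℕ, m ≤ n →
      (∀ g ∈ gateValues (Ψ₀ ++ sumProdDelta c ops Ψ₀.length m), ∃ e : ℕ, IsWeightedHomogeneous w g e) ∧
      (∀ x ∈ gateWDepths prodWeight (Ψ₀ ++ sumProdDelta c ops Ψ₀.length m),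
        x ∈ gateWDepths prodWeight Ψ₀ ∨ x ≤ D₀ + 1) ∧
      ∀ i < m, sumProdPos Ψ₀.length nJ i < (Ψ₀ ++ sumProdDelta c ops Ψ₀.length m).length ∧
        (gateValues (Ψ₀ ++ sumProdDelta c ops Ψ₀.length m)).getD (sumProdPos Ψ₀.length nJ i) 0 =
          ∑ j : Fin nJ, C (c i j) * ∏ u : Fin f, (ops i j u).eval (gateValues Ψ₀) ∧
        IsWeightedHomogeneous w
          ((gateValues (Ψ₀ ++ sumProdDelta c ops Ψ₀.length m)).getD (sumProdPos Ψ₀.length nJ i) 0)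
          (W i) ∧
        (gateWDepths prodWeight (Ψ₀ ++ sumProdDelta c ops Ψ₀.length m)).getD
          (sumProdPos Ψ₀.length nJ i) 0 ≤ D₀ + 1
  | 0, _ => by
      refine ⟨?_, ?_, fun i hi => absurd hi (Nat.not_lt_zero i)⟩
      · simpa [sumProdDelta] using hhom₀
      · intro x hx
        left
        simpa [sumProdDelta] using hx
  | m + 1, hm => by
      obtain ⟨ihhom, ihdep, ihout⟩ := sumProdDelta_spec Ψ₀ n D₀ W hrefs hdp hhom₀ hW m (by omega)
      have hmn : m < n := by omega
      -- the list after `m` steps and its prefix decompositions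
      set Ψ := Ψ₀ ++ sumProdDelta c ops Ψ₀.length m with hΨ
      have hlen : Ψ.length = Ψ₀.length + m * (nJ + 1) := by
        rw [hΨ, List.length_append, length_sumProdDelta]
      obtain ⟨XV, hXV, -⟩ := gateValues_prefix Ψ₀ (sumProdDelta c ops Ψ₀.length m)
      obtain ⟨XD, hXD, -⟩ := gateWDepths_prefix prodWeight Ψ₀ (sumProdDelta c ops Ψ₀.length m)
      have heval : ∀ j u, (ops m j u).eval (gateValues Ψ) = (ops m j u).eval (gateValues Ψ₀) := by
        intro j u
        rw [hΨ, hXV]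
        exact operand_eval_append_of_refsBelow _ _
          ((gateValues_length Ψ₀).symm ▸ hrefs m hmn j u)
      have hdepth : ∀ j u, (ops m j u).depthIn (gateWDepths prodWeight Ψ) =
          (ops m j u).depthIn (gateWDepths prodWeight Ψ₀) := by
        intro j u
        rw [hΨ, hXD]
        exact depthIn_append_of_refsBelow _ _
          ((gateWDepths_length prodWeight Ψ₀).symm ▸ hrefs m hmn j u)
      -- the step, applied to `Ψ`
      have hstep := sumProd_step w (c m) (ops m) Ψ D₀ (W m)
        (fun j u => Operand.refsBelow_mono (by rw [hlen]; omega) (hrefs m hmn j u))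
        (fun j u => (hdepth j u).symm ▸ hdp m hmn j u)
        ihhom
        (fun j => by
          have := hW m hmn j
          simpa only [heval] using this)
      obtain ⟨hL, -, hhomS, hdepS, hvalS, hhomvS, hdS⟩ := hstep
      -- rewrite the `(m+1)`-st list as the step applied to `Ψ`
      have hshape : Ψ₀ ++ sumProdDelta c ops Ψ₀.length (m + 1) =
          Ψ ++ prodLayer (ops m) ++ [sumGate (c m) Ψ.length] := by
        rw [sumProdDelta, hlen, hΨ, List.append_assoc, List.append_assoc]
      rw [hshape]
      refine ⟨hhomS, ?_, ?_⟩
      · intro x hx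
        rcases hdepS x hx with hx' | hx'
        · exact ihdep x hx'
        · exact Or.inr hx'
      intro i hi
      by_cases him : i < m
      · -- an old sum gate: everything is preserved in the prefix `Ψ`
        obtain ⟨hpos, hval, hhv, hd⟩ := ihout i him
        have hpos' : sumProdPos Ψ₀.length nJ i < Ψ.length := hpos
        obtain ⟨YV, hYV, -⟩ := gateValues_prefix Ψ (prodLayer (ops m) ++ [sumGate (c m) Ψ.length])
        obtain ⟨YD, hYD, -⟩ :=
          gateWDepths_prefix prodWeight Ψ (prodLayer (ops m) ++ [sumGate (c m) Ψ.length])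
        rw [← List.append_assoc] at hYV hYD
        have hv' : (gateValues (Ψ ++ prodLayer (ops m) ++ [sumGate (c m) Ψ.length])).getD
            (sumProdPos Ψ₀.length nJ i) 0 = (gateValues Ψ).getD (sumProdPos Ψ₀.length nJ i) 0 := by
          rw [hYV, List.getD_append _ _ _ _ (by rw [gateValues_length]; exact hpos')]
        have hd' : (gateWDepths prodWeight (Ψ ++ prodLayer (ops m) ++ [sumGate (c m) Ψ.length])).getD
            (sumProdPos Ψ₀.length nJ i) 0 =
            (gateWDepths prodWeight Ψ).getD (sumProdPos Ψ₀.length nJ i) 0 := by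
          rw [hYD, List.getD_append _ _ _ _ (by rw [gateWDepths_length]; exact hpos')]
        refine ⟨?_, ?_, ?_, ?_⟩
        · rw [hL]; omega
        · rw [hv']; exact hval
        · rw [hv']; exact hhv
        · rw [hd']; exact hd
      · -- the new sum gate `i = m`
        have hieq : i = m := by omega
        subst hieq
        have hposeq : sumProdPos Ψ₀.length nJ i = Ψ.length + nJ := by
          rw [sumProdPos, hlen]
        rw [hposeq]
        refine ⟨by rw [hL]; omega, ?_, hhomvS, hdS⟩
        rw [hvalS]
        refine Finset.sum_congr rfl fun j _ => ?_
        simp_rw [heval]
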